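import Summits.NavierStokesRegularity.NavierStokesRegularity.Theorems.TautLoopKelvinCirculationFloorExtension
import Literature.Analysis.FluidPDE.NSLerayBlowupRateTopHolds
import Mathlib.Topology.Algebra.Order.LiminfLimsup
import HarnessLib

/-!
# Fluid computer — the LEVEL-REYNOLDS FLOOR (R2 amplitude rung): a maximal smooth solution has `limsup_j sup_t 2^{-j}‖Δ̇_j u(t)‖_∞ ≥ c ν`

HONEST FRAMING (cell `pub-fluidc`, verbatim): *low prior, high value-of-information experiment on Tao's
machine paradigm; NOT a claim that NS blows up.* This file is on the THEOREM side of the cell (the floors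
every cascade design must respect); nothing here is evidence of blow-up.

The cell's amplitude rung (HOME/PLAN.md §0, SCHEMA.md 9.21) tabulates, per energy-transfer step of scale
ratio `λ`, the band sup-velocity gain `g = U_out/U_in` and the LEVEL-REYNOLDS RATIO `r = g/λ`, against the
machine floor `r ≥ 1` and the classical null `r = λ^{-4/3}`. The floor is a NECESSITY, and this file proves
the theorem behind it in the tree's vocabulary of maximal smooth solutions
(`Literature.Analysis.FluidPDE.IsMaximalSmoothSolution`, Beale–Kato–Majda's continuation vocabulary) and
Littlewood–Paley blocks (`Literature.Analysis.FunctionSpaces.lpBlockWeight (-1) ∞ U j = 2^{-j}‖Δ̇_j U‖_∞`, the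
"level-`j` Reynolds number times `ν`"):

* The continuation step — a classical solution on `[0, T)` which is Leray–Hopf from its datum and
  `H¹`-regular on `(0, T]` extends classically past `T` (Leray's structure-theorem mechanism: uniform `H¹`
  bound near `T`, Leray's local regular solution from a good restarting time with a lifespan independent of
  that time, weak–strong uniqueness in Serrin's class `L^∞_t L⁶_x`, gluing) — is ALREADY LANDED in the tree as
  `Summit.NavierStokesRegularity.NavierStokesRegularity.Theorems.CirculationFloor.Birth.extension_of_isH1RegularOn_Ioc`
  (crux `TautLoopKelvin.CirculationFloor`, Robinson–Rodrigo–Sadowski 2016, proof of Thm. 12.3) and is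
  imported, not re-proved (gate dedup rule).
* `dyadic_floor` (**L1**, the floor theorem) — contrapositive of Cheskidov–Shvydkoy 2010, Lemma 3.2
  [cite: CheskidovShvydkoy2010, Lemma 3.2], DISCHARGED in the tree as
  `cheskidov_shvydkoy_dyadic_regular_holds`: there is an absolute `c > 0` such that every maximal smooth
  solution with finite lifespan `T` which is Leray–Hopf from its datum satisfies
  `limsup_{j → ∞} sup_{t ∈ (0,T)} 2^{-j} ‖Δ̇_j u(t)‖_∞ ≥ c ν`.
* `level_amplitude_frequently_gt` (**L2**, cascade reading) — for every `b < c`, infinitely many dyadic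
  levels `j` carry a time `t < T` with `2^{-j}‖Δ̇_j u(t)‖_∞ > b ν`: a blow-up organised through levels
  `k_j = 2^j` needs level sup-amplitudes `U_j` with level Reynolds numbers `U_j/(ν k_j) > b` at
  infinitely many levels, i.e. the geometric-mean gain per level is at least the scale ratio — the
  dictionary entry `r_floor = 1` of SCHEMA 9.21(c) / SPEC-SHEET §2(D′) `re_gain_floor`.
* `level_supnorm_frequently_gt` (**L2′**, appended 2026-08-22) — the same with `lpBlockWeight` unfolded: for every
  `b < c`, infinitely many levels `j` have `sup_{t ∈ (0,T)} ‖Δ̇_j U(t)‖_∞ > b ν 2^j` (level amplitude above `b ν k_j`).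
* `besov_jump_floor` (**L4**, appended 2026-08-23 — the ABRUPTNESS floor) — contrapositive of Cheskidov–Shvydkoy 2010,
  Thm. 3.1 [cite: CheskidovShvydkoy2010, Thm. 3.1] (through the tree's `isH1RegularOn_of_jumps_lt` = its printed proof, with
  `cheskidov_shvydkoy_dyadic_regular_holds` and `leray_continuation_H1_holds`): with an absolute `c > 0`, every maximal smooth
  solution with lifespan `T`, Leray–Hopf from `u 0`, has `sup_{t ∈ (0,T]} limsup_{t₀ → t⁻} ‖U t − U t₀‖_{B^{-1}_{∞,∞}} ≥ c ν`:
  a blow-up needs LEFT JUMPS of size `c ν` in the largest critical space — the trajectory cannot hand its amplitude over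
  continuously in `B^{-1}_{∞,∞}` (the cell's "abrupt transfer" necessity, ASSEMBLY.md §2).
* `levelReynolds_not_tendsto_zero` (**L1′**, appended 2026-08-23) — the "ladder does not die" form of L1: the level
  amplitudes `sup_{t ∈ (0,T)} 2^{-j}‖Δ̇_j U(t)‖_∞` do NOT tend to `0` as `j → ∞` (the `Dies` predicate of the cell's amplitude
  ladders is excluded for every realised blow-up).
* `leray_level_floor` (**L3**, explicit floor under the spec clock) — from Leray's rate
  `‖u(t)‖_∞ ≥ c √ν (T - t)^{-1/2}` [cite: Leray1934, §19 (3.8)–(3.9)], DISCHARGED as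
  `leray_blowup_rate_top_holds`: if at a hand-over time `t < T` the velocity is dominated by the level
  amplitude, `‖u(t)‖_∞ ≤ U`, and the time left obeys the cell's spec clock `T - t ≤ K · c_T/(k U)`
  (geometric tail `K` times the eddy turn-over time `c_T/(k U)` of the level of wavenumber `k`), then the
  level Reynolds number is bounded below by an absolute quantity: `U/(ν k) ≥ c²/(K c_T)`.

0 sorry; axioms ⊆ {propext, Classical.choice, Quot.sound}; no named fact is introduced (every PDE input is
a DISCHARGED theorem of the tree: `cheskidov_shvydkoy_dyadic_regular_holds`,
`CirculationFloor.Birth.extension_of_isH1RegularOn_Ioc`, `leray_blowup_rate_top_holds`).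

## References

* A. Cheskidov, R. Shvydkoy, *The regularity of weak solutions of the 3D Navier–Stokes equations in
  `B^{-1}_{∞,∞}`*, Arch. Ration. Mech. Anal. 195 (2010) 159–169 = arXiv:0708.3067, Lemma 3.2, Thm. 2.4.
  [CheskidovShvydkoy2010]
* J. Leray, *Sur le mouvement d'un liquide visqueux emplissant l'espace*, Acta Math. 63 (1934), §§19–24.
  [Leray1934]
* W. S. Ożański, B. C. Pooley, *Leray's fundamental work on the Navier–Stokes equations*, LMS LN 452 (2018),
  Thm. 6.30, Cor. 6.16. [OzanskiPooley2018]
* J. C. Robinson, J. L. Rodrigo, W. Sadowski, *The Three-Dimensional Navier–Stokes Equations*, CUP 2016,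
  Lemma 8.4, Thm. 8.14, Thm. 8.19. [RobinsonRodrigoSadowski2016]
-/

noncomputable section

open MeasureTheory Set Function Filter Topology TemperedDistribution
open scoped ENNReal NNReal SchwartzMap
open Literature.Analysis.FluidPDE Literature.Analysis.FunctionSpaces
open Summit.NavierStokesRegularity.NavierStokesRegularity.Theorems (CirculationFloor.Birth.extension_of_isH1RegularOn_Ioc)

namespace Summit.NavierStokesRegularity.FluidComputer.LevelReynoldsFloor

/-- **L1 — the level-Reynolds floor (dyadic form).** Contrapositive of Cheskidov–Shvydkoy 2010,
Lemma 3.2 (arXiv:0708.3067, p. 5: "There is a constant `c > 0` such that if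
`limsup_{q → ∞} sup_{t ∈ (0,T)} λ_q⁻¹ ‖u_q(t)‖_∞ < cν` then `u(t)` is regular on `(0,T]`"), in the
tree's blow-up vocabulary (the shape of ns.S28 `leray_blowup_rate_top`): there is an absolute `c > 0` such
that for every `ν > 0`, `T > 0`, every maximal smooth solution `(u, p)` of the unforced Navier–Stokes system
on `ℝ³ × [0, T)` (classical on `[0, T)`, no classical continuation past `T`) which is a Leray–Hopf weak
solution from `u 0`, and the tempered distributions `U t` of the slices `u t`,
`c ν ≤ limsup_{j → ∞} sup_{t ∈ (0,T)} 2^{-j} ‖Δ̇_j U(t)‖_∞` (`lpBlockWeight (-1) ∞ (U t) j`). Proof: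
otherwise Lemma 3.2 (`cheskidov_shvydkoy_dyadic_regular_holds`, discharged in the tree) makes `u`
`H¹`-regular on `(0, T]`, and the landed continuation lemma `CirculationFloor.Birth.extension_of_isH1RegularOn_Ioc`
continues it past `T`, contradicting maximality. Compared with the landed
`CirculationFloor.Birth.stub_extension_of_dyadicSmall` (same chain, stated as an extension criterion for
classical solutions from a rapidly decaying datum) this is the blow-up-side contrapositive for maximal smooth
solutions, with no decay hypothesis on the datum. [cite: CheskidovShvydkoy2010, Lemma 3.2] -/
theorem dyadic_floor :
    ∃ c : ℝ, 0 < c ∧ ∀ (ν T : ℝ), 0 < ν → 0 < T → ∀ (u : ℝ → EuclideanSpace ℝ (Fin 3) → EuclideanSpace ℝ (Fin 3))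
      (p : ℝ → EuclideanSpace ℝ (Fin 3) → ℝ)
      (U : ℝ → 𝓢'(EuclideanSpace ℝ (Fin 3), EuclideanSpace ℂ (Fin 3))), IsMaximalSmoothSolution ν 0 u p T → IsLerayHopfOn T ν 0 (u 0) u →
      (∀ t ∈ Icc 0 T, IsDistributionOf (u t) (U t)) →
      ENNReal.ofReal (c * ν) ≤
        limsup (fun j : ℕ => ⨆ t ∈ Ioo 0 T, lpBlockWeight (-1) ∞ (U t) (j : ℤ)) atTop := by
  obtain ⟨c, hc, H⟩ := cheskidov_shvydkoy_dyadic_regular_holds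
  refine ⟨c, hc, fun ν T hν hT u p U hmax hLH hU => ?_⟩
  by_contra hlt
  have hreg : IsH1RegularOn (Ioc 0 T) u := H ν T hν hT (u 0) u U hLH hU (not_le.1 hlt)
  exact hmax.2 (CirculationFloor.Birth.extension_of_isH1RegularOn_Ioc hν hT hmax.1 hLH hreg)

/-- **L2 — cascade reading of the floor: infinitely many levels beat viscosity.** With the constant `c`
of `dyadic_floor`: for every maximal smooth solution `(u, p)` with lifespan `T` which is Leray–Hopf from
`u 0` (distributions `U t` of the slices) and every `b < c`, there are INFINITELY MANY dyadic levels `j`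
at which some time `t ∈ (0, T)` has `2^{-j} ‖Δ̇_j U(t)‖_∞ > b ν` — in cascade language (levels
`k_j = 2^j`, level sup-amplitude `U_j = sup_t ‖Δ̇_j u(t)‖_∞`, level Reynolds number `Re_j = U_j/(ν k_j)`):
`Re_j > b` for infinitely many `j`, so the gain per level cannot stay below the scale ratio
(`U_{j+1}/U_j ≤ 2^{1-ε}` eventually would force `Re_j → 0`). This is the `r_floor = 1` line of the cell's
amplitude rung (SCHEMA.md 9.21(c), SPEC-SHEET §2(D′) `re_gain_floor`), obtained from `dyadic_floor` by
`Filter.frequently_lt_of_lt_limsup`. [cite: CheskidovShvydkoy2010, Lemma 3.2] -/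
theorem level_amplitude_frequently_gt :
    ∃ c : ℝ, 0 < c ∧ ∀ (ν T : ℝ), 0 < ν → 0 < T → ∀ (u : ℝ → EuclideanSpace ℝ (Fin 3) → EuclideanSpace ℝ (Fin 3))
      (p : ℝ → EuclideanSpace ℝ (Fin 3) → ℝ)
      (U : ℝ → 𝓢'(EuclideanSpace ℝ (Fin 3), EuclideanSpace ℂ (Fin 3))), IsMaximalSmoothSolution ν 0 u p T → IsLerayHopfOn T ν 0 (u 0) u →
      (∀ t ∈ Icc 0 T, IsDistributionOf (u t) (U t)) →
      ∀ b : ℝ, b < c →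
        ∃ᶠ j : ℕ in atTop, ENNReal.ofReal (b * ν) < ⨆ t ∈ Ioo 0 T, lpBlockWeight (-1) ∞ (U t) (j : ℤ) := by
  obtain ⟨c, hc, H⟩ := dyadic_floor
  refine ⟨c, hc, fun ν T hν hT u p U hmax hLH hU b hb => ?_⟩
  have hfloor := H ν T hν hT u p U hmax hLH hU
  have hbν : ENNReal.ofReal (b * ν) < ENNReal.ofReal (c * ν) :=
    (ENNReal.ofReal_lt_ofReal_iff (mul_pos hc hν)).2 (mul_lt_mul_of_pos_right hb hν)
  exact frequently_lt_of_lt_limsup (by isBoundedDefault) (hbν.trans_le hfloor)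

/-- **L3 — the explicit level-Reynolds floor under the spec clock** (Leray 1934, §19 (3.8)–(3.9):
`V(t) > A √(ν/(T - t))` before a blow-up time; in the tree `leray_blowup_rate_top_holds`, DISCHARGED). With
Leray's absolute constant `c`: let `(u, p)` be a maximal smooth solution with lifespan `T` of the unforced
system on `ℝ³ × [0, T)`, Leray–Hopf from `u 0` and essentially bounded on every closed sub-strip
`[0, T'] × ℝ³`, `T' < T` (the hypotheses of ns.S28). If at a time `t ∈ [0, T)` the velocity is dominated
by a level amplitude `U ≥ 0`, `‖u(t)‖_{L^∞} ≤ U`, and the time to blow-up obeys the cell's SPEC CLOCK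
`T - t ≤ K · (c_T / (k U))` (`k > 0` the level wavenumber, `c_T/(k U)` its eddy turn-over time, `K > 0` the
geometric-tail factor; SPEC-SHEET §(assembly), `Literature.Analysis.FluidPDE.FluidComputer.CascadeSpecs`),
then the LEVEL REYNOLDS NUMBER has the absolute floor `U/(ν k) ≥ c²/(K c_T)`. Proof: Leray gives
`c √ν ≤ U √(T - t)`, so `c² ν ≤ U² (T - t) ≤ U K c_T / k`. [cite: Leray1934, §19 (3.8)–(3.9) p. 224] -/
theorem leray_level_floor :
    ∃ c : ℝ, 0 < c ∧ ∀ (ν T : ℝ), 0 < ν → 0 < T → ∀ (u : ℝ → EuclideanSpace ℝ (Fin 3) → EuclideanSpace ℝ (Fin 3))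
      (p : ℝ → EuclideanSpace ℝ (Fin 3) → ℝ), IsMaximalSmoothSolution ν 0 u p T → IsLerayHopfOn T ν 0 (u 0) u →
      (∀ T' ∈ Ioo 0 T, eLpNorm (uncurry u) ∞ (volume.restrict (Icc 0 T' ×ˢ univ)) < ∞) →
      ∀ t ∈ Ico 0 T, ∀ (U k K cT : ℝ), 0 ≤ U → 0 < k → 0 < K → 0 < cT →
        eLpNorm (u t) ∞ volume ≤ ENNReal.ofReal U → T - t ≤ K * (cT / (k * U)) →
        c / (K * cT) ≤ U / (ν * k) := by
  obtain ⟨c, hc, H⟩ := leray_blowup_rate_top_holds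
  refine ⟨c ^ 2, pow_pos hc 2, fun ν T hν hT u p hmax hLH hbdd t ht U k K cT hU hk hK hcT hsup hclock => ?_⟩
  have hTt : 0 < T - t := sub_pos.2 ht.2
  -- Leray: `c √ν / √(T - t) ≤ U`
  have hrate : c * Real.sqrt ν / Real.sqrt (T - t) ≤ U :=
    (ENNReal.ofReal_le_ofReal_iff hU).1 ((H ν T hν hT u p hmax hLH hbdd t ht).trans hsup)
  have hsq : 0 < Real.sqrt (T - t) := Real.sqrt_pos.2 hTt
  rw [div_le_iff₀ hsq] at hrate
  -- square: `c² ν ≤ U² (T - t)`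
  have h2 : c ^ 2 * ν ≤ U ^ 2 * (T - t) := by
    have h0 : 0 ≤ c * Real.sqrt ν := mul_nonneg hc.le (Real.sqrt_nonneg ν)
    have h1 : (c * Real.sqrt ν) ^ 2 ≤ (U * Real.sqrt (T - t)) ^ 2 := pow_le_pow_left₀ h0 hrate 2
    rw [mul_pow, mul_pow, Real.sq_sqrt hν.le, Real.sq_sqrt hTt.le] at h1
    exact h1
  -- `U > 0` (else `c² ν ≤ 0`)
  have hUpos : 0 < U := by
    rcases hU.eq_or_lt with h0 | h0
    · rw [← h0] at h2
      nlinarith [mul_pos (pow_pos hc 2) hν]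
    · exact h0
  -- spec clock: `U² (T - t) ≤ U K c_T / k`
  have h3 : U ^ 2 * (T - t) ≤ U * K * cT / k := by
    calc U ^ 2 * (T - t) ≤ U ^ 2 * (K * (cT / (k * U))) := mul_le_mul_of_nonneg_left hclock (sq_nonneg U)
      _ = U * K * cT / k := by field_simp
  have h4 : c ^ 2 * ν ≤ U * K * cT / k := h2.trans h3
  rw [div_le_div_iff₀ (mul_pos hK hcT) (mul_pos hν hk)]
  rw [le_div_iff₀ hk] at h4
  nlinarith [h4]

/-- **L2′ — the same in level-amplitude form: `sup_t ‖Δ̇_j u(t)‖_∞ > b ν 2^j` at infinitely many levels.**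
Unfolding `lpBlockWeight (-1) ∞ U j = 2^{-j} ‖Δ̇_j U‖_∞` in `level_amplitude_frequently_gt`: with the constant `c` of
`dyadic_floor`, for every maximal smooth solution `(u, p)` with lifespan `T`, Leray–Hopf from `u 0`, with slice
distributions `U t`, and every `b < c`, there are infinitely many dyadic levels `j` (wavenumber `k_j = 2^j`) whose
LEVEL AMPLITUDE `U_j := sup_{t ∈ (0,T)} ‖Δ̇_j U(t)‖_{L^∞}` exceeds `b ν k_j` — level Reynolds number
`U_j/(ν k_j) > b`. This is the literal form of the `r_floor = 1` line of the amplitude rung (SCHEMA.md 9.21(c)):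
along the levels of any blow-up the amplitude must, infinitely often, be at least a fixed multiple of `ν k_j`, so the
per-level gain cannot stay below the scale ratio. [cite: CheskidovShvydkoy2010, Lemma 3.2] -/
theorem level_supnorm_frequently_gt :
    ∃ c : ℝ, 0 < c ∧ ∀ (ν T : ℝ), 0 < ν → 0 < T → ∀ (u : ℝ → EuclideanSpace ℝ (Fin 3) → EuclideanSpace ℝ (Fin 3))
      (p : ℝ → EuclideanSpace ℝ (Fin 3) → ℝ)
      (U : ℝ → 𝓢'(EuclideanSpace ℝ (Fin 3), EuclideanSpace ℂ (Fin 3))),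
      IsMaximalSmoothSolution ν 0 u p T → IsLerayHopfOn T ν 0 (u 0) u →
      (∀ t ∈ Icc 0 T, IsDistributionOf (u t) (U t)) →
      ∀ b : ℝ, b < c →
        ∃ᶠ j : ℕ in atTop, ENNReal.ofReal (b * ν) * (2 : ℝ≥0∞) ^ j <
          ⨆ t ∈ Ioo 0 T, eLpNormDistrib ∞ (lpBlock (j : ℤ) (U t)) := by
  obtain ⟨c, hc, H⟩ := level_amplitude_frequently_gt
  refine ⟨c, hc, fun ν T hν hT u p U hmax hLH hU b hb => ?_⟩
  refine (H ν T hν hT u p U hmax hLH hU b hb).mono fun j hj => ?_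
  -- `lpBlockWeight (-1) ∞ v j = (2^j)⁻¹ * ‖Δ̇_j v‖_∞`
  have hpow : (2 : ℝ≥0∞) ^ ((j : ℤ) * (-1 : ℝ)) = ((2 : ℝ≥0∞) ^ j)⁻¹ := by
    rw [mul_neg_one, ENNReal.rpow_neg]
    norm_cast
  have h2j0 : (2 : ℝ≥0∞) ^ j ≠ 0 := pow_ne_zero _ two_ne_zero
  have h2jtop : (2 : ℝ≥0∞) ^ j ≠ ∞ := ENNReal.pow_ne_top ENNReal.ofNat_ne_top
  have hsup : (⨆ t ∈ Ioo 0 T, lpBlockWeight (-1) ∞ (U t) (j : ℤ)) =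
      ((2 : ℝ≥0∞) ^ j)⁻¹ * ⨆ t ∈ Ioo 0 T, eLpNormDistrib ∞ (lpBlock (j : ℤ) (U t)) := by
    simp only [lpBlockWeight, hpow, ENNReal.mul_iSup]
  rw [hsup] at hj
  have := ENNReal.mul_lt_mul_left h2j0 h2jtop hj
  rwa [mul_comm ((2 : ℝ≥0∞) ^ j)⁻¹, mul_assoc, ENNReal.inv_mul_cancel h2j0 h2jtop, mul_one] at this

/-- **L4 — the jump floor (abruptness necessity).** Contrapositive of Cheskidov–Shvydkoy 2010, Thm. 3.1
(arXiv:0708.3067, p. 5: "If `sup_{t ∈ (0,T]} limsup_{t₀ → t-} ‖u(t) - u(t₀)‖_{B^{-1}_{∞,∞}} < cν` … then `u(t)` is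
regular on `(0,T]`"), in the tree's blow-up vocabulary: there is an absolute `c > 0` such that for every `ν > 0`, `T > 0`,
every maximal smooth solution `(u, p)` of the unforced Navier–Stokes system on `ℝ³ × [0, T)` which is Leray–Hopf from `u 0`,
and the tempered distributions `U t` of its slices (`t ∈ [0, T]`, the slice at `T` being the weak-`L²` limit),
`c ν ≤ sup_{t ∈ (0,T]} limsup_{t₀ → t⁻} ‖U t − U t₀‖_{B^{-1}_{∞,∞}}` (inhomogeneous norm `eBesovNorm (-1) ∞ ∞`). Proof:
otherwise the printed proof of Thm. 3.1 (`isH1RegularOn_of_jumps_lt`, fed with the discharged Lemma 3.2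
`cheskidov_shvydkoy_dyadic_regular_holds` and Thm. 2.4 `leray_continuation_H1_holds`) makes `u` `H¹`-regular on
`(0, T]`, and `CirculationFloor.Birth.extension_of_isH1RegularOn_Ioc` continues it past `T`. The constant is half the
constant of `dyadic_floor`. [cite: CheskidovShvydkoy2010, Thm. 3.1] -/
theorem besov_jump_floor :
    ∃ c : ℝ, 0 < c ∧ ∀ (ν T : ℝ), 0 < ν → 0 < T → ∀ (u : ℝ → EuclideanSpace ℝ (Fin 3) → EuclideanSpace ℝ (Fin 3))
      (p : ℝ → EuclideanSpace ℝ (Fin 3) → ℝ)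
      (U : ℝ → 𝓢'(EuclideanSpace ℝ (Fin 3), EuclideanSpace ℂ (Fin 3))),
      IsMaximalSmoothSolution ν 0 u p T → IsLerayHopfOn T ν 0 (u 0) u →
      (∀ t ∈ Icc 0 T, IsDistributionOf (u t) (U t)) →
      ENNReal.ofReal (c * ν) ≤
        ⨆ t ∈ Ioc 0 T, limsup (fun t₀ => eBesovNorm (-1) ∞ ∞ (U t - U t₀)) (𝓝[<] t) := by
  obtain ⟨c, hc, H32⟩ := cheskidov_shvydkoy_dyadic_regular_holds
  refine ⟨c / 2, half_pos hc, fun ν T hν hT u p U hmax hLH hU => ?_⟩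
  by_contra hlt
  have hreg : IsH1RegularOn (Ioc 0 T) u :=
    isH1RegularOn_of_jumps_lt H32 leray_continuation_H1_holds hν hT hLH hU (not_le.1 hlt)
  exact hmax.2 (CirculationFloor.Birth.extension_of_isH1RegularOn_Ioc hν hT hmax.1 hLH hreg)

/-- **L1′ — the level Reynolds numbers of a blow-up do not die.** For every maximal smooth solution `(u, p)` with
lifespan `T` of the unforced Navier–Stokes system on `ℝ³ × [0, T)`, Leray–Hopf from `u 0`, and every family `U t`
of slice distributions, the level amplitudes `j ↦ sup_{t ∈ (0,T)} 2^{-j} ‖Δ̇_j U(t)‖_∞` do NOT tend to `0`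
(their `limsup` is at least `c ν > 0` by `dyadic_floor`). In the cell's ladder vocabulary
(`AmplitudeLedger`, idea-2's `AmplitudeLadder.Dies`): no realised blow-up has a dying ladder.
[cite: CheskidovShvydkoy2010, Lemma 3.2] -/
theorem levelReynolds_not_tendsto_zero {ν T : ℝ} (hν : 0 < ν) (hT : 0 < T)
    {u : ℝ → EuclideanSpace ℝ (Fin 3) → EuclideanSpace ℝ (Fin 3)} {p : ℝ → EuclideanSpace ℝ (Fin 3) → ℝ}
    {U : ℝ → 𝓢'(EuclideanSpace ℝ (Fin 3), EuclideanSpace ℂ (Fin 3))}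
    (hmax : IsMaximalSmoothSolution ν 0 u p T) (hLH : IsLerayHopfOn T ν 0 (u 0) u)
    (hU : ∀ t ∈ Icc 0 T, IsDistributionOf (u t) (U t)) :
    ¬ Tendsto (fun j : ℕ => ⨆ t ∈ Ioo 0 T, lpBlockWeight (-1) ∞ (U t) (j : ℤ)) atTop (𝓝 0) := by
  intro hlim
  obtain ⟨c, hc, H⟩ := dyadic_floor
  have hfloor := H ν T hν hT u p U hmax hLH hU
  rw [hlim.limsup_eq] at hfloor
  exact absurd (le_antisymm hfloor bot_le) (ENNReal.ofReal_pos.2 (mul_pos hc hν)).ne'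

end Summit.NavierStokesRegularity.FluidComputer.LevelReynoldsFloor

end
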